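import Literature.MathematicalPhysics.QuantumFieldTheory.Balaban1983to89.T4AxialGaugeSmallField
import Literature.MathematicalPhysics.QuantumFieldTheory.Balaban1983to89.T3ContinuumYM3Torus
import Literature.MathematicalPhysics.QuantumFieldTheory.Balaban1983to89.T4HaarSU2Translate
import Literature.MathematicalPhysics.QuantumFieldTheory.Balaban1983to89.T4WilsonLinkAffine
import Summits.QuantumFields.YangMills.Theorems.BackwardLiouvilleRigidityFlatRatioTerminationConeGeometry

/-!
# The cubical skeleton of the three-torus at mesh `2m`: cells, reduction, faces, dimension count
# (toolkit for the stub `stub_innerWindowGaugeSmall` of `BackwardLiouvilleRigidity.FlatRatioTermination`, stmt-QuantumFields-22542)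

The finest lattice `Site (F.P K) 0 = (ℤ/N)³`, `N = 2L^{m_F + K}`, of a `T3Family` is read through integer representatives
`rep s ∈ [0, N)³` (`castSite (rep s) = s`).  At mesh `2m ∣ N` the ALIGNED CELLS are the `Cone.Cell 3` with `lo ∈ (2mℤ)³`; every
integer point `x` lies in the relative interior of exactly one aligned cell `cellAt m x` (`lo κ = 2m⌊x κ/2m⌋`, active directions
those with `2m ∤ x κ`).  Proved: box membership, the dimension count (`cellAt` of a point of the closed box of an aligned cell `c`
has its active set inside `c.D`, strictly inside on `∂c`), the identification `cellAt m z = c` for relative-interior points,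
periodicity of `castSite`, and the FACE LEMMA (two adjacent boundary points of a cell lie in the closed box of an aligned cell of
smaller dimension).  Group-level identities: `‖su2Quat g − su2Quat h‖ = dist1 (g h⁻¹)` and the quotient estimate
`dist1 (v a⁻¹ (v' a'⁻¹)⁻¹) ≤ dist1 (v U v'⁻¹) + dist1 (a U a'⁻¹)`.

HONEST SCOPE.  Lattice bookkeeping, `--supports stmt-QuantumFields-22542`; nothing about the crux, rung R3 or any summit statement;
nothing here bears on the Yang–Mills mass gap.
-/

namespace Summit.QuantumFields.YangMills.Theorems.FlatRatioTermination.Skeleton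

open Literature.MathematicalPhysics.QuantumFieldTheory.Balaban1983to89
open Literature.MathematicalPhysics.QuantumFieldTheory.Balaban1983to89.T3ContinuumYM3Torus
open Literature.MathematicalPhysics.QuantumFieldTheory.Balaban1983to89.T4AxialGaugeSmallField
open Literature.MathematicalPhysics.QuantumLattice
open B7Prop1Explicit (e e_apply)
open Cone (Cell)
open scoped Quaternion

local notation "SU2" => Matrix.specialUnitaryGroup (Fin 2) ℂ

/-! ## §1 Group-level identities -/

section Algebra

variable {G : Type*} [GaugeGroup G]

/-- THE QUOTIENT ESTIMATE: `dist1 (v a⁻¹ (v' a'⁻¹)⁻¹) ≤ dist1 (v U v'⁻¹) + dist1 (a U a'⁻¹)` for any bond variable `U`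
(`v a⁻¹ a' v'⁻¹ = (v U v'⁻¹)·c (a U a'⁻¹)⁻¹ c⁻¹`, `c = v' a'⁻¹`). [folklore] -/
theorem dist1_quot_le (v a v' a' U : G) :
    dist1 (v * a⁻¹ * (v' * a'⁻¹)⁻¹) ≤ dist1 (v * U * v'⁻¹) + dist1 (a * U * a'⁻¹) := by
  have h : v * a⁻¹ * (v' * a'⁻¹)⁻¹ = (v * U * v'⁻¹) * ((v' * a'⁻¹) * (a * U * a'⁻¹)⁻¹ * (v' * a'⁻¹)⁻¹) := by group
  rw [h]
  calc dist1 ((v * U * v'⁻¹) * ((v' * a'⁻¹) * (a * U * a'⁻¹)⁻¹ * (v' * a'⁻¹)⁻¹))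
      ≤ dist1 (v * U * v'⁻¹) + dist1 ((v' * a'⁻¹) * (a * U * a'⁻¹)⁻¹ * (v' * a'⁻¹)⁻¹) := GaugeGroup.dist1_mul_le _ _
    _ = dist1 (v * U * v'⁻¹) + dist1 (a * U * a'⁻¹) := by rw [GaugeGroup.dist1_conj, GaugeGroup.dist1_inv]

/-- In the quaternion model the chord distance is the distance of the quotient from `1`:
`‖su2Quat g − su2Quat h‖ = dist1 (g h⁻¹)`. [folklore] -/
theorem norm_su2Quat_sub (g h : SU2) : ‖su2Quat g - su2Quat h‖ = dist1 (g * h⁻¹) := by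
  rw [T4ExpWindowSmallField.dist1_eq_norm_su2Quat_sub_one, T4HaarSU2Translate.su2Quat_mul,
    T4WilsonLinkAffine.su2Quat_inv]
  have h1 : su2Quat h * star (su2Quat h) = 1 := by
    rw [Quaternion.self_mul_star, normSq_su2Quat]; norm_cast
  have e : su2Quat g * star (su2Quat h) - 1 = (su2Quat g - su2Quat h) * star (su2Quat h) := by
    rw [sub_mul, h1]
  rw [e, norm_mul, norm_star, norm_su2Quat, mul_one]

/-- For unit quaternions `p, q`: `dist1 (quatToSU2 p · (quatToSU2 q)⁻¹) = ‖p − q‖`. [folklore] -/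
theorem dist1_quatToSU2_mul_inv {p q : ℍ} (hp : ‖p‖ = 1) (hq : ‖q‖ = 1) :
    dist1 (quatToSU2 p * (quatToSU2 q)⁻¹) = ‖p - q‖ := by
  have hp0 : p ≠ 0 := by intro h; rw [h, norm_zero] at hp; exact zero_ne_one hp
  have hq0 : q ≠ 0 := by intro h; rw [h, norm_zero] at hq; exact zero_ne_one hq
  rw [← norm_su2Quat_sub, T4HaarSU2Translate.su2Quat_quatToSU2 hp0, T4HaarSU2Translate.su2Quat_quatToSU2 hq0,
    hp, hq, inv_one, one_smul, one_smul]

/-- `quatToSU2 (su2Quat (g)) = g` read backwards on a product: `quatToSU2 (su2Quat (v a⁻¹)) · a = v`. [folklore] -/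
theorem quatToSU2_su2Quat_mul_inv_mul (v a : SU2) : quatToSU2 (su2Quat (v * a⁻¹)) * a = v := by
  rw [quatToSU2_su2Quat, inv_mul_cancel_right]

end Algebra

/-! ## §2 Integer representatives and periodicity -/

section Torus

variable (F : T3Family) (K : ℕ)

/-- The integer representative in `[0, N)³` of a site of the finest lattice. [folklore] -/
def rep (s : Site (F.P K) 0) : Fin 3 → ℤ := fun κ => (((s κ).val : ℕ) : ℤ)

/-- `castSite ∘ rep = id`. [folklore] -/
theorem castSite_rep (s : Site (F.P K) 0) : (castSite (rep F K s) : Site (F.P K) 0) = s := by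
  funext κ
  simp [castSite, rep]

/-- The representative lies in `[0, N)`. [folklore] -/
theorem rep_bounds (s : Site (F.P K) 0) (κ : Fin 3) :
    0 ≤ rep F K s κ ∧ rep F K s κ < ((F.P K).sitesPerDir 0 : ℤ) := by
  refine ⟨Int.natCast_nonneg _, ?_⟩
  simp only [rep]
  exact_mod_cast ZMod.val_lt (s κ)

/-- Points of `[0, N)³` are their own representatives. [folklore] -/
theorem rep_castSite {x : Fin 3 → ℤ} (hx : ∀ κ, 0 ≤ x κ ∧ x κ < ((F.P K).sitesPerDir 0 : ℤ)) :
    rep F K (castSite x : Site (F.P K) 0) = x := by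
  funext κ
  simp only [rep, castSite_apply]
  rw [ZMod.val_intCast]
  exact Int.emod_eq_of_lt (hx κ).1 (hx κ).2

/-- The representative of `castSite x` is congruent to `x` modulo `N`. [folklore] -/
theorem dvd_rep_castSite_sub (x : Fin 3 → ℤ) (κ : Fin 3) :
    ((F.P K).sitesPerDir 0 : ℤ) ∣ rep F K (castSite x : Site (F.P K) 0) κ - x κ := by
  simp only [rep, castSite_apply]
  rw [ZMod.val_intCast]
  have h := Int.mul_ediv_add_emod (x κ) ((F.P K).sitesPerDir 0 : ℤ)
  exact ⟨-(x κ / ((F.P K).sitesPerDir 0 : ℤ)), by linarith⟩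

/-- PERIODICITY: integer points congruent modulo `N` coordinatewise give the same site. [folklore] -/
theorem castSite_eq_of_modEq {x y : Fin 3 → ℤ} (h : ∀ κ, ((F.P K).sitesPerDir 0 : ℤ) ∣ x κ - y κ) :
    (castSite x : Site (F.P K) 0) = castSite y := by
  funext κ
  simp only [castSite_apply]
  rw [ZMod.intCast_eq_intCast_iff_dvd_sub]
  have := h κ
  rwa [dvd_sub_comm] at this

end Torus

/-! ## §3 Aligned cells at mesh `2m` -/

section Cells

/-- The aligned cells of mesh `2m`: lower corner in `(2mℤ)³`, half-side `m`. [folklore] -/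
def cells (m : ℕ) : Set (Cell 3) := {c | c.m = m ∧ ∀ κ, (2 * m : ℤ) ∣ c.lo κ}

/-- The aligned cell containing the integer point `x` in its relative interior. [folklore] -/
def cellAt (m : ℕ) (x : Fin 3 → ℤ) : Cell 3 :=
  { lo := fun κ => 2 * m * (x κ / (2 * m))
    D := Finset.univ.filter (fun κ => ¬ ((2 * m : ℤ) ∣ x κ))
    m := m }

variable {m : ℕ}

/-- Unfolding the lower corner of `cellAt`. [folklore] -/
@[simp] theorem cellAt_lo (x : Fin 3 → ℤ) (κ : Fin 3) : (cellAt m x).lo κ = 2 * m * (x κ / (2 * m)) := rfl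

/-- Unfolding the half-side of `cellAt`. [folklore] -/
@[simp] theorem cellAt_m (x : Fin 3 → ℤ) : (cellAt m x).m = m := rfl

/-- Unfolding the active directions of `cellAt`. [folklore] -/
theorem mem_cellAt_D (x : Fin 3 → ℤ) (κ : Fin 3) : κ ∈ (cellAt m x).D ↔ ¬ ((2 * m : ℤ) ∣ x κ) := by
  simp [cellAt]

/-- `cellAt m x` is an aligned cell. [folklore] -/
theorem cellAt_mem_cells (x : Fin 3 → ℤ) : cellAt m x ∈ cells m :=
  ⟨rfl, fun κ => ⟨x κ / (2 * m), rfl⟩⟩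

/-- Division with remainder at modulus `2m`. [folklore] -/
theorem ediv_bounds (hm : 1 ≤ m) (y : ℤ) :
    2 * m * (y / (2 * m)) ≤ y ∧ y < 2 * m * (y / (2 * m)) + 2 * m := by
  have hM : (0 : ℤ) < 2 * m := by omega
  have h1 := Int.mul_ediv_add_emod y (2 * m)
  have h2 := Int.emod_nonneg y hM.ne'
  have h3 := Int.emod_lt_of_pos y hM
  constructor <;> linarith

/-- The point lies in the box of its cell. [folklore] -/
theorem mem_box_cellAt (hm : 1 ≤ m) (x : Fin 3 → ℤ) : x ∈ (cellAt m x).box := by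
  intro κ
  obtain ⟨h1, h2⟩ := ediv_bounds hm (x κ)
  by_cases h : κ ∈ (cellAt m x).D
  · rw [(cellAt m x).hi_of_mem h]; simp only [cellAt_lo, cellAt_m]; omega
  · rw [(cellAt m x).hi_of_not_mem h]; simp only [cellAt_lo]
    rw [mem_cellAt_D, not_not] at h
    obtain ⟨q, hq⟩ := h
    have hM : (2 * m : ℤ) ≠ 0 := by omega
    rw [hq, Int.mul_ediv_cancel_left _ hM]
    exact ⟨le_rfl, le_rfl⟩

/-- A multiple of `2m` has quotient recovered exactly. [folklore] -/
theorem ediv_of_mem_Ico (hm : 1 ≤ m) {q y : ℤ} (h1 : 2 * m * q ≤ y) (h2 : y < 2 * m * q + 2 * m) :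
    y / (2 * m) = q := by
  have hM : (0 : ℤ) < 2 * m := by omega
  obtain ⟨h3, h4⟩ := ediv_bounds hm y
  -- both `q` and `y / (2m)` satisfy the same bracketing
  have h5 : 2 * m * (y / (2 * m)) < 2 * m * (q + 1) := by linarith
  have h6 : 2 * m * q < 2 * m * (y / (2 * m) + 1) := by linarith
  have h7 := lt_of_mul_lt_mul_left h5 hM.le
  have h8 := lt_of_mul_lt_mul_left h6 hM.le
  omega

variable {c : Cell 3}

/-- DIMENSION COUNT: for a point `z` of the closed box of an aligned cell `c`, every active direction of `cellAt m y` — `y` any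
point congruent to `z` modulo a multiple of `2m` — is active for `c`. [folklore] -/
theorem cellAt_D_subset (hc : c ∈ cells m) {z y : Fin 3 → ℤ} (hz : z ∈ c.box) (hy : ∀ κ, (2 * m : ℤ) ∣ y κ - z κ) :
    (cellAt m y).D ⊆ c.D := by
  intro κ hκ
  rw [mem_cellAt_D] at hκ
  by_contra hD
  apply hκ
  have h1 : z κ = c.lo κ := c.eq_lo_of_not_mem hz hD
  have h2 := (hc.2 κ)
  rw [← h1] at h2
  have := (hy κ).add h2
  simpa using this

/-- On the boundary the count is strict: the extreme coordinate is inactive for `cellAt m y`. [folklore] -/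
theorem card_cellAt_D_lt (hc : c ∈ cells m) {z y : Fin 3 → ℤ} (hz : z ∈ c.bdry) (hy : ∀ κ, (2 * m : ℤ) ∣ y κ - z κ) :
    (cellAt m y).D.card < c.D.card := by
  obtain ⟨hzb, κ₀, hκ₀, hv⟩ := hz
  have hsub := cellAt_D_subset hc hzb hy
  have hκ₀' : κ₀ ∉ (cellAt m y).D := by
    rw [mem_cellAt_D, not_not]
    have h2 : (2 * m : ℤ) ∣ z κ₀ := by
      rcases hv with h | h
      · rw [h]; exact hc.2 κ₀
      · rw [h, hc.1]; exact (hc.2 κ₀).add ⟨1, by ring⟩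
    have := (hy κ₀).add h2
    simpa using this
  exact Finset.card_lt_card ⟨hsub, fun h => hκ₀' (h hκ₀)⟩

/-- In particular the count never increases on the closed box. [folklore] -/
theorem card_cellAt_D_le (hc : c ∈ cells m) {z y : Fin 3 → ℤ} (hz : z ∈ c.box) (hy : ∀ κ, (2 * m : ℤ) ∣ y κ - z κ) :
    (cellAt m y).D.card ≤ c.D.card :=
  Finset.card_le_card (cellAt_D_subset hc hz hy)

/-- RELATIVE INTERIOR: a point of the closed box off the boundary recovers the cell: `cellAt m z = c`. [folklore] -/
theorem cellAt_eq_of_not_mem_bdry (hm : 1 ≤ m) (hc : c ∈ cells m) {z : Fin 3 → ℤ} (hz : z ∈ c.box) (hzb : z ∉ c.bdry) :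
    cellAt m z = c := by
  have hcm := hc.1
  have key : ∀ κ, (cellAt m z).lo κ = c.lo κ ∧ (κ ∈ (cellAt m z).D ↔ κ ∈ c.D) := by
    intro κ
    obtain ⟨q, hq⟩ := hc.2 κ
    have hzκ := hz κ
    by_cases hD : κ ∈ c.D
    · rw [c.hi_of_mem hD, hcm] at hzκ
      have hne1 : z κ ≠ c.lo κ := fun h => hzb ⟨hz, κ, hD, Or.inl h⟩
      have hne2 : z κ ≠ c.lo κ + 2 * m := fun h => hzb ⟨hz, κ, hD, Or.inr (by rw [hcm]; exact h)⟩
      have hlt1 : c.lo κ < z κ := lt_of_le_of_ne hzκ.1 (Ne.symm hne1)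
      have hlt2 : z κ < c.lo κ + 2 * m := lt_of_le_of_ne hzκ.2 hne2
      have hdiv : z κ / (2 * m) = q := ediv_of_mem_Ico hm (by rw [← hq]; exact hlt1.le) (by rw [← hq]; exact hlt2)
      refine ⟨by simp [hdiv, hq], ?_⟩
      rw [mem_cellAt_D]
      refine ⟨fun _ => hD, fun _ => ?_⟩
      rintro ⟨r, hr⟩
      have hM : (0 : ℤ) < 2 * m := by omega
      -- `2m q < 2m r < 2m q + 2m` is impossible
      rw [hr, hq] at hlt1 hlt2
      have h1 := lt_of_mul_lt_mul_left hlt1 hM.le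
      have h2 : 2 * (m : ℤ) * r < 2 * m * (q + 1) := by linarith
      have h3 := lt_of_mul_lt_mul_left h2 hM.le
      omega
    · rw [c.hi_of_not_mem hD] at hzκ
      have hzeq : z κ = c.lo κ := le_antisymm hzκ.2 hzκ.1
      have hM : (2 * m : ℤ) ≠ 0 := by omega
      refine ⟨by simp [hzeq, hq, Int.mul_ediv_cancel_left _ hM], ?_⟩
      rw [mem_cellAt_D]
      exact ⟨fun h => absurd (by rw [hzeq, hq]; exact ⟨q, rfl⟩) h, fun h => absurd h hD⟩
  rcases c with ⟨lo, D, m'⟩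
  simp only [cellAt, Cell.mk.injEq]
  refine ⟨funext fun κ => (key κ).1, ?_, hcm.symm ▸ rfl⟩
  · ext κ; simpa [cellAt] using (key κ).2

/-- THE FACE LEMMA: two adjacent boundary points of an aligned cell lie in the closed box of an aligned cell of strictly smaller
dimension (the common face: a coordinate `κ ≠ ι` extreme for both). [folklore] -/
theorem face_cell (hm : 1 ≤ m) (hc : c ∈ cells m) {z : Fin 3 → ℤ} {ι : Fin 3} (hz : z ∈ c.bdry) (hz' : z + e ι ∈ c.bdry) :
    ∃ c' ∈ cells m, c'.D.card < c.D.card ∧ z ∈ c'.box ∧ z + e ι ∈ c'.box := by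
  have hcm := hc.1
  -- a common extreme coordinate `κ ≠ ι`
  obtain ⟨hzb, κ₁, hκ₁, hv₁⟩ := hz
  obtain ⟨hzb', κ₂, hκ₂, hv₂⟩ := hz'
  have hcommon : ∃ κ ∈ c.D, κ ≠ ι ∧ (z κ = c.lo κ ∨ z κ = c.lo κ + 2 * c.m) := by
    by_cases h1 : κ₁ = ι
    · by_cases h2 : κ₂ = ι
      · exfalso
        rw [h1] at hv₁ hκ₁
        rw [h2] at hv₂
        have e1 : (z + e ι) ι = z ι + 1 := by simp [e_apply]
        rw [e1] at hv₂
        have hlo := (hzb ι).1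
        have hhi := (hzb' ι).2
        rw [c.hi_of_mem hκ₁, e1] at hhi
        have hm1 : 1 ≤ c.m := hcm ▸ hm
        rcases hv₁ with h | h <;> rcases hv₂ with h' | h' <;> omega
      · refine ⟨κ₂, hκ₂, h2, ?_⟩
        have e2 : (z + e ι) κ₂ = z κ₂ := by simp [e_apply, h2]
        rwa [e2] at hv₂
    · exact ⟨κ₁, hκ₁, h1, hv₁⟩
  obtain ⟨κ, hκ, hκι, hv⟩ := hcommon
  refine ⟨⟨Function.update c.lo κ (z κ), c.D.erase κ, c.m⟩, ⟨hcm, fun μ => ?_⟩, ?_, ?_, ?_⟩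
  · by_cases hμ : μ = κ
    · subst hμ; simp only [Function.update_self]
      rcases hv with h | h
      · rw [h]; exact hc.2 μ
      · rw [h, hcm]; exact (hc.2 μ).add ⟨1, by ring⟩
    · simp only [Function.update_of_ne hμ]; exact hc.2 μ
  · exact Finset.card_erase_lt_of_mem hκ
  · intro μ
    by_cases hμ : μ = κ
    · subst hμ
      have : μ ∉ c.D.erase μ := Finset.notMem_erase μ c.D
      simp [Cell.hi, this]
    · have h := hzb μ
      have hmem : μ ∈ c.D.erase κ ↔ μ ∈ c.D := by simp [hμ]
      by_cases hD : μ ∈ c.D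
      · rw [c.hi_of_mem hD] at h
        have : μ ∈ c.D.erase κ := hmem.mpr hD
        simp only [Cell.hi, this, if_true, Function.update_of_ne hμ]; exact h
      · rw [c.hi_of_not_mem hD] at h
        have : μ ∉ c.D.erase κ := fun h' => hD (hmem.mp h')
        simp only [Cell.hi, this, if_false, Function.update_of_ne hμ]; exact h
  · intro μ
    by_cases hμ : μ = κ
    · subst hμ
      have : μ ∉ c.D.erase μ := Finset.notMem_erase μ c.D
      simp [Cell.hi, this, e_apply, hκι]
    · have h := hzb' μ
      have hmem : μ ∈ c.D.erase κ ↔ μ ∈ c.D := by simp [hμ]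
      by_cases hD : μ ∈ c.D
      · rw [c.hi_of_mem hD] at h
        have : μ ∈ c.D.erase κ := hmem.mpr hD
        simp only [Cell.hi, this, if_true, Function.update_of_ne hμ]; exact h
      · rw [c.hi_of_not_mem hD] at h
        have : μ ∉ c.D.erase κ := fun h' => hD (hmem.mp h')
        simp only [Cell.hi, this, if_false, Function.update_of_ne hμ]; exact h

/-- In a REDUCED aligned cell (`0 ≤ lo κ < N`, `2m ∣ N`) the box stays below `N`: `lo κ + 2m ≤ N`. [folklore] -/
theorem lo_add_le_of_reduced (hm : 1 ≤ m) (hc : c ∈ cells m) {N : ℤ} (hN : (2 * m : ℤ) ∣ N) {κ : Fin 3}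
    (hlo : c.lo κ < N) : c.lo κ + 2 * m ≤ N := by
  obtain ⟨q, hq⟩ := hc.2 κ
  obtain ⟨n, hn⟩ := hN
  rw [hq, hn] at hlo ⊢
  have hM : (0 : ℤ) < 2 * m := by omega
  have h1 := lt_of_mul_lt_mul_left hlo hM.le
  nlinarith

/-- The translate of a cell by an integer vector. [folklore] -/
def translate (c : Cell 3) (t : Fin 3 → ℤ) : Cell 3 := ⟨fun κ => c.lo κ - t κ, c.D, c.m⟩

/-- Upper corner of the translate. [folklore] -/
theorem hi_translate (c : Cell 3) (t : Fin 3 → ℤ) (κ : Fin 3) : (translate c t).hi κ = c.hi κ - t κ := by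
  by_cases h : κ ∈ c.D
  · rw [c.hi_of_mem h, (translate c t).hi_of_mem (by exact h)]; simp [translate]; ring
  · rw [c.hi_of_not_mem h, (translate c t).hi_of_not_mem (by exact h)]; simp [translate]

/-- Boxes correspond under translation. [folklore] -/
theorem mem_box_translate (c : Cell 3) (t z : Fin 3 → ℤ) : z ∈ c.box ↔ z - t ∈ (translate c t).box := by
  simp only [Cell.mem_box, hi_translate, Pi.sub_apply]
  constructor
  · intro h κ; have := h κ; simp only [translate]; constructor <;> linarith [this.1, this.2]
  · intro h κ; have := h κ; simp only [translate] at this; constructor <;> linarith [this.1, this.2]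

/-- Boundaries correspond under translation. [folklore] -/
theorem mem_bdry_translate (c : Cell 3) (t z : Fin 3 → ℤ) : z ∈ c.bdry ↔ z - t ∈ (translate c t).bdry := by
  rw [Cell.mem_bdry, Cell.mem_bdry, ← mem_box_translate]
  have hD : (translate c t).D = c.D := rfl
  have hm : (translate c t).m = c.m := rfl
  have hlo : ∀ κ, (translate c t).lo κ = c.lo κ - t κ := fun κ => rfl
  simp only [hD, hm, hlo, Pi.sub_apply]
  constructor
  · rintro ⟨h, κ, hκ, hv⟩
    exact ⟨h, κ, hκ, by rcases hv with hv | hv <;> [left; right] <;> linarith⟩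
  · rintro ⟨h, κ, hκ, hv⟩
    exact ⟨h, κ, hκ, by rcases hv with hv | hv <;> [left; right] <;> linarith⟩

/-- REDUCTION: every aligned cell is the translate by a multiple of `N` of a REDUCED aligned cell (`0 ≤ lo κ < N`). [folklore] -/
theorem exists_reduced (hc : c ∈ cells m) {N : ℤ} (hN : (2 * m : ℤ) ∣ N) (hN0 : 0 < N) :
    ∃ w : Fin 3 → ℤ, translate c (fun κ => N * w κ) ∈ cells m ∧
      ∀ κ, 0 ≤ (translate c (fun κ => N * w κ)).lo κ ∧ (translate c (fun κ => N * w κ)).lo κ < N := by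
  refine ⟨fun κ => c.lo κ / N, ⟨hc.1, fun κ => ?_⟩, fun κ => ?_⟩
  · exact (hc.2 κ).sub (hN.mul_right _)
  · have h1 := Int.mul_ediv_add_emod (c.lo κ) N
    have h2 := Int.emod_nonneg (c.lo κ) hN0.ne'
    have h3 := Int.emod_lt_of_pos (c.lo κ) hN0
    simp only [translate]
    constructor <;> linarith

end Cells

end Summit.QuantumFields.YangMills.Theorems.FlatRatioTermination.Skeleton
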